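import Summits.CriticalPhenomena.CardyFormulaZ2.Theorems.CardyDualCurrentCanonicalLimitFromExactCRThreadedObstruction
import Summits.CriticalPhenomena.CardyFormulaZ2.Theorems.CardyDualCurrentDualCurrentTemplateRStubIntegrandIntegrable

/-!
# Real form of the dual-current question, and what it says about the SHAPE stub
(crux stmt-CriticalPhenomena-11394 `CardyDualCurrent.CanonicalLimitFromExactCR`, line `registered`)

The crux is `DualCurrentTemplateR → TemplateCanonicalLimit` (r2 → r9, `Iff.rfl`; reduction
landed in `CardyDualCurrentCanonicalLimitFromExactCRReduction.lean`), and both remaining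
registered stubs of line `registered` carry the body of the decision crux r2
(`DualCurrentTemplateR`, stmt-CriticalPhenomena-11201) as antecedent.  This file records, in
kernel-checked form, the structure of that antecedent which the SHAPE stub
`stub_shapeBoundsAndIdentification` has to work with once a witness exists.

* **Linear structure.** Templates of equal range can be juxtaposed (`append`) and scaled
  (`smul`); on admissible data the observable is additive / homogeneous (`obs_append`,
  `obs_smul`; additivity needs the integrability of the template integrand,
  `integrable_templateIntegrand`), and exact discrete holomorphicity is preserved
  (`isExactCRIn_append`, `isExactCRIn_smul`).
* **Real and imaginary parts.** With the conjugate-staggering `T†` of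
  `CardyDualCurrentCanonicalLimitFromExactCRStubLimitAntiHolomorphic.lean`
  (`T†.obs (·,0) = conj T.obs (·,0)`, `T†.obs (·,1) = - conj T.obs (·,1)`), the templates
  `rePart T = T ⊕ T†` and `imPart T = (-i) T ⊕ i T†` have the same range as `T`, are exactly CR
  when `T` is, are of REAL FORM — horizontal observable real, vertical observable purely
  imaginary, in every admissible domain (`rePart_realForm`, `imPart_realForm`) — and reconstruct
  `T.obs = (rePart T).obs / 2 + i (imPart T).obs / 2` (`obs_eq_parts`).  Hence
  (`nondegenerate_rePart_or_imPart`) one of them is non-degenerate when `T` is, and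
  **`DualCurrentTemplateR` is equivalent to the existence of an exactly-CR, deep-window
  non-degenerate template of real form** (`dualCurrentTemplateR_iff_exists_realForm`): the
  dual-current question asks for ONE real discrete Cauchy–Riemann pair `(a, d)` —
  `a = Re G(·,0)` on horizontal edges, `d = Im G(·,1)` on vertical edges,
  `d(x) - d(x - e₁) = a(x) - a(x - e₀)` at deep vertices and
  `a(f + e₁) - a(f) = -(d(f + e₀) - d(f))` at deep faces (`isExactCRIn_iff_realPair`) — of local
  percolation expectations, not for a complex function (the census unknowns of the negative
  items are real).
* **Consequence for the SHAPE stub.** A real-form template has NO projective limit of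
  horizontal type, in any Dobrushin domain, along any discretisation family, for any
  renormalisation (`realForm_projective_false`: its conjugate-staggering has the same horizontal
  observable on admissible data, and `conjStagger_projective_false` applies).  So the template
  the SHAPE stub must re-choose under r2 is necessarily a genuinely complex combination
  `P ⊕ i Q` of TWO exactly-CR real-form currents `P`, `Q`, both non-degenerate, whose real pairs
  converge (after one common normalisation) to `(Re q, Im q)` and `(Im q, -Re q)` respectively —
  two matched currents, not one.
-/

noncomputable section

namespace Summit.CriticalPhenomena.CardyFormulaZ2.Cruxes.CanonicalLimitFromExactCR.Birth

open scoped Topology ComplexConjugate BigOperators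
open Filter Set Complex MeasureTheory
open Literature.Probability Literature.Probability.LatticeModels
  Literature.Probability.RandomPlanarGeometry
open Summit.CriticalPhenomena.CardyFormulaZ2.Theses.CardyDualCurrent (DualCurrentTemplateR)
open Summit.CriticalPhenomena.CardyFormulaZ2.Theorems (integrable_templateIntegrand)
open AntiHolomorphic (conjStagger obs_conjStagger_zero obs_conjStagger_one isExactCRIn_conjStagger)
open Obstruction (isExactCR_conjStagger conjStagger_projective_false)

namespace RealForm

/-! ### Linear structure on templates of equal range -/

/-- **Juxtaposition** of two templates of the same range: the terms of `T'` are appended to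
those of `T` (`Fin.append` on passage vertices, spins and local weights). [folklore] -/
def append (T T' : LocalParafermionicTemplate) (hr : T'.r = T.r) : LocalParafermionicTemplate where
  r := T.r
  m := T.m + T'.m
  z := fun i => Fin.append (T.z i) (T'.z i)
  s := fun i => Fin.append (T.s i) (T'.s i)
  g := fun i => Fin.append (T.g i) (T'.g i)
  dist_le := fun i k => by
    induction k using Fin.addCases with
    | left k => simpa only [Fin.append_left] using T.dist_le i k
    | right k => simpa only [Fin.append_right, hr] using T'.dist_le i k

/-- **Scaling** of a template by a complex number (all local weights multiplied by `c`).
[folklore] -/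
def smul (c : ℂ) (T : LocalParafermionicTemplate) : LocalParafermionicTemplate where
  r := T.r
  m := T.m
  z := T.z
  s := T.s
  g := fun i k P => c * T.g i k P
  dist_le := T.dist_le

/-- The range of a juxtaposition. [folklore] -/
theorem append_r (T T' : LocalParafermionicTemplate) (hr : T'.r = T.r) :
    (append T T' hr).r = T.r := rfl

/-- The range of a scaled template. [folklore] -/
theorem smul_r (c : ℂ) (T : LocalParafermionicTemplate) : (smul c T).r = T.r := rfl

/-- The range of the conjugate-staggered template. [folklore] -/
theorem conjStagger_r (T : LocalParafermionicTemplate) : (conjStagger T).r = T.r := rfl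

/-- The observable of an explicitly given template (the sum runs over `Fin m` literally).
[folklore] -/
theorem obs_mk (r m : ℕ) (z : Fin 2 → Fin m → MedialVertex) (s : Fin 2 → Fin m → ℝ)
    (g : Fin 2 → Fin m → Set MedialVertex → ℂ)
    (h : ∀ i k, medialGraph.edist s((0 : Site 2), Pi.single i 1) (z i k) ≤ (r : ℕ∞))
    (D : DiscreteDobrushin) (x : Site 2) (i : Fin 2) :
    (⟨r, m, z, s, g, h⟩ : LocalParafermionicTemplate).obs D x i =
      ∫ ω, (∑ k : Fin m, g i k {e |
          medialGraph.edist s((0 : Site 2), Pi.single i 1) e ≤ (r : ℕ∞) ∧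
          Sym2.map (· + x) e ∈ ω} *
        Literature.Probability.LatticeModels.passageSum (fkInterface D ω) D.δ (s i k)
          (Sym2.map (· + x) (z i k)))
        ∂(Percolation.bondPercolation (zdGraph 2) Percolation.half) :=
  rfl

/-- The observable of a scaled template is the scaled observable (no integrability needed).
[folklore] -/
theorem obs_smul (c : ℂ) (T : LocalParafermionicTemplate) (D : DiscreteDobrushin) (x : Site 2)
    (i : Fin 2) : (smul c T).obs D x i = c * T.obs D x i := by
  unfold smul
  rw [obs_mk, LocalParafermionicTemplate.obs_eq, ← integral_const_mul]
  refine integral_congr_ae (Eventually.of_forall fun ω => ?_)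
  dsimp only
  rw [Finset.mul_sum]
  exact Finset.sum_congr rfl fun k _ => by ring

/-- In an admissible domain the observable of a juxtaposition is the sum of the observables
(both integrands are integrable, `integrable_templateIntegrand`). [folklore] -/
theorem obs_append (T T' : LocalParafermionicTemplate) (hr : T'.r = T.r) {D : DiscreteDobrushin}
    (hD : D.IsZdAdmissible) (x : Site 2) (i : Fin 2) :
    (append T T' hr).obs D x i = T.obs D x i + T'.obs D x i := by
  have hT := integrable_templateIntegrand T D hD x i
  have hT' := integrable_templateIntegrand T' D hD x i
  rw [LocalParafermionicTemplate.obs_eq T']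
  rw [hr] at hT' ⊢
  unfold append
  rw [obs_mk, LocalParafermionicTemplate.obs_eq, ← integral_add hT hT']
  refine integral_congr_ae (Eventually.of_forall fun ω => ?_)
  dsimp only
  rw [Fin.sum_univ_add]
  simp only [Fin.append_left, Fin.append_right]

/-- Templates of equal range have the same depth predicate. [folklore] -/
theorem isDeep_iff_of_r_eq {T T' : LocalParafermionicTemplate} (hr : T'.r = T.r)
    (D : DiscreteDobrushin) (x : Site 2) (i : Fin 2) : T'.IsDeep D x i ↔ T.IsDeep D x i := by
  unfold LocalParafermionicTemplate.IsDeep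
  rw [hr]

/-- Scaling preserves exact discrete holomorphicity in a domain. [folklore] -/
theorem isExactCRIn_smul (c : ℂ) {T : LocalParafermionicTemplate} {D : DiscreteDobrushin}
    (h : T.IsExactCRIn D) : (smul c T).IsExactCRIn D := by
  constructor
  · intro x h0 h1 h2 h3
    have key := h.1 x h0 h1 h2 h3
    simp only [obs_smul]
    linear_combination c * key
  · intro f h0 h1 h2 h3
    have key := h.2 f h0 h1 h2 h3
    simp only [obs_smul]
    linear_combination c * key

/-- Juxtaposition preserves exact discrete holomorphicity in an admissible domain. [folklore] -/
theorem isExactCRIn_append {T T' : LocalParafermionicTemplate} (hr : T'.r = T.r)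
    {D : DiscreteDobrushin} (hD : D.IsZdAdmissible) (h : T.IsExactCRIn D)
    (h' : T'.IsExactCRIn D) : (append T T' hr).IsExactCRIn D := by
  have hd : ∀ x i, (append T T' hr).IsDeep D x i → T'.IsDeep D x i :=
    fun x i hx => (isDeep_iff_of_r_eq hr D x i).2 hx
  constructor
  · intro x h0 h1 h2 h3
    have k1 := h.1 x h0 h1 h2 h3
    have k2 := h'.1 x (hd _ _ h0) (hd _ _ h1) (hd _ _ h2) (hd _ _ h3)
    simp only [obs_append T T' hr hD]
    linear_combination k1 + k2
  · intro f h0 h1 h2 h3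
    have k1 := h.2 f h0 h1 h2 h3
    have k2 := h'.2 f (hd _ _ h0) (hd _ _ h1) (hd _ _ h2) (hd _ _ h3)
    simp only [obs_append T T' hr hD]
    linear_combination k1 + k2

/-! ### Real and imaginary parts of a template -/

/-- The **real part** `T ⊕ T†` of a template (same range, twice as many terms). [folklore] -/
def rePart (T : LocalParafermionicTemplate) : LocalParafermionicTemplate :=
  append T (conjStagger T) (conjStagger_r T)

/-- Range bookkeeping for `imPart`. [folklore] -/
theorem smul_conjStagger_r (T : LocalParafermionicTemplate) :
    (smul I (conjStagger T)).r = (smul (-I) T).r := rfl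

/-- The **imaginary part** `(-i) T ⊕ i T†` of a template (same range, twice as many terms).
[folklore] -/
def imPart (T : LocalParafermionicTemplate) : LocalParafermionicTemplate :=
  append (smul (-I) T) (smul I (conjStagger T)) (smul_conjStagger_r T)

/-- Horizontal observable of the real part: `G + conj G`. [folklore] -/
theorem obs_rePart_zero (T : LocalParafermionicTemplate) {D : DiscreteDobrushin}
    (hD : D.IsZdAdmissible) (x : Site 2) :
    (rePart T).obs D x 0 = T.obs D x 0 + conj (T.obs D x 0) := by
  rw [rePart, obs_append T (conjStagger T) (conjStagger_r T) hD, obs_conjStagger_zero]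

/-- Vertical observable of the real part: `G - conj G`. [folklore] -/
theorem obs_rePart_one (T : LocalParafermionicTemplate) {D : DiscreteDobrushin}
    (hD : D.IsZdAdmissible) (x : Site 2) :
    (rePart T).obs D x 1 = T.obs D x 1 - conj (T.obs D x 1) := by
  rw [rePart, obs_append T (conjStagger T) (conjStagger_r T) hD, obs_conjStagger_one]
  ring

/-- Horizontal observable of the imaginary part: `-i (G - conj G)`. [folklore] -/
theorem obs_imPart_zero (T : LocalParafermionicTemplate) {D : DiscreteDobrushin}
    (hD : D.IsZdAdmissible) (x : Site 2) :
    (imPart T).obs D x 0 = -I * (T.obs D x 0 - conj (T.obs D x 0)) := by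
  rw [imPart, obs_append (smul (-I) T) (smul I (conjStagger T)) (smul_conjStagger_r T) hD, obs_smul,
    obs_smul, obs_conjStagger_zero]
  ring

/-- Vertical observable of the imaginary part: `-i (G + conj G)`. [folklore] -/
theorem obs_imPart_one (T : LocalParafermionicTemplate) {D : DiscreteDobrushin}
    (hD : D.IsZdAdmissible) (x : Site 2) :
    (imPart T).obs D x 1 = -I * (T.obs D x 1 + conj (T.obs D x 1)) := by
  rw [imPart, obs_append (smul (-I) T) (smul I (conjStagger T)) (smul_conjStagger_r T) hD, obs_smul,
    obs_smul, obs_conjStagger_one]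
  ring

/-- **The real part is of real form**: horizontal observable real, vertical observable purely
imaginary, in every admissible domain. [folklore] -/
theorem rePart_realForm (T : LocalParafermionicTemplate) :
    ∀ D : DiscreteDobrushin, D.IsZdAdmissible → ∀ x : Site 2,
      ((rePart T).obs D x 0).im = 0 ∧ ((rePart T).obs D x 1).re = 0 := by
  intro D hD x
  rw [obs_rePart_zero T hD, obs_rePart_one T hD]
  constructor
  · simp
  · simp

/-- **The imaginary part is of real form**. [folklore] -/
theorem imPart_realForm (T : LocalParafermionicTemplate) :
    ∀ D : DiscreteDobrushin, D.IsZdAdmissible → ∀ x : Site 2,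
      ((imPart T).obs D x 0).im = 0 ∧ ((imPart T).obs D x 1).re = 0 := by
  intro D hD x
  rw [obs_imPart_zero T hD, obs_imPart_one T hD]
  constructor
  · simp
  · simp

/-- **Reconstruction**: on admissible data `G = (rePart-observable + i · imPart-observable) / 2`,
for both edge types. [folklore] -/
theorem obs_eq_parts (T : LocalParafermionicTemplate) {D : DiscreteDobrushin}
    (hD : D.IsZdAdmissible) (x : Site 2) (i : Fin 2) :
    T.obs D x i = ((rePart T).obs D x i + I * (imPart T).obs D x i) / 2 := by
  fin_cases i
  · simp only [Fin.zero_eta, Fin.isValue]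
    rw [obs_rePart_zero T hD, obs_imPart_zero T hD]
    linear_combination (norm := ring_nf) (T.obs D x 0 - conj (T.obs D x 0)) / 2 * I_sq
  · simp only [Fin.mk_one, Fin.isValue]
    rw [obs_rePart_one T hD, obs_imPart_one T hD]
    linear_combination (norm := ring_nf) (T.obs D x 1 + conj (T.obs D x 1)) / 2 * I_sq

/-- If both parts are constant on the deep vertices of an admissible domain, so is `T`.
[folklore] -/
theorem isConstantIn_of_parts {T : LocalParafermionicTemplate} {D : DiscreteDobrushin}
    (hD : D.IsZdAdmissible) (hP : (rePart T).IsConstantIn D) (hQ : (imPart T).IsConstantIn D) :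
    T.IsConstantIn D := by
  intro x x' i hx hx'
  rw [obs_eq_parts T hD x i, obs_eq_parts T hD x' i, hP x x' i hx hx', hQ x x' i hx hx']

/-- **One of the two parts of a non-degenerate template is non-degenerate.** [folklore] -/
theorem nondegenerate_rePart_or_imPart {T : LocalParafermionicTemplate} (h : T.Nondegenerate) :
    (rePart T).Nondegenerate ∨ (imPart T).Nondegenerate := by
  by_contra hcon
  rw [not_or] at hcon
  obtain ⟨hP, hQ⟩ := hcon
  unfold LocalParafermionicTemplate.Nondegenerate at hP hQ
  rw [not_not] at hP hQ
  exact h fun D hD hconn => isConstantIn_of_parts hD (hP D hD hconn) (hQ D hD hconn)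

/-- The real part of an exactly-CR template is exactly CR. [folklore] -/
theorem isExactCR_rePart {T : LocalParafermionicTemplate} (h : T.IsExactCR) :
    (rePart T).IsExactCR :=
  fun D hD hconn =>
    isExactCRIn_append (conjStagger_r T) hD (h D hD hconn) (isExactCRIn_conjStagger (h D hD hconn))

/-- The imaginary part of an exactly-CR template is exactly CR. [folklore] -/
theorem isExactCR_imPart {T : LocalParafermionicTemplate} (h : T.IsExactCR) :
    (imPart T).IsExactCR :=
  fun D hD hconn => isExactCRIn_append (smul_conjStagger_r T) hD (isExactCRIn_smul _ (h D hD hconn))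
    (isExactCRIn_smul _ (isExactCRIn_conjStagger (h D hD hconn)))

/-! ### The dual-current question in real form -/

/-- **`DualCurrentTemplateR` in real form.** The decision crux r2 of route `CardyDualCurrent`
(stmt-CriticalPhenomena-11201: some finite-range local parafermionic template is exactly
discrete-holomorphic and deep-window non-degenerate) is EQUIVALENT to the existence of such a
template OF REAL FORM — horizontal observable real and vertical observable purely imaginary in
every admissible domain: given any witness `T`, one of `rePart T`, `imPart T` is a real-form
witness. [folklore] -/
theorem dualCurrentTemplateR_iff_exists_realForm : Summit.CriticalPhenomena.CardyFormulaZ2.Theses.CardyDualCurrent.DualCurrentTemplateR ↔ ∃ T : Literature.Probability.LatticeModels.LocalParafermionicTemplate, T.IsExactCR ∧ T.Nondegenerate ∧ ∀ D : Literature.Probability.LatticeModels.DiscreteDobrushin, D.IsZdAdmissible → ∀ x : Literature.Probability.LatticeModels.Site 2, (T.obs D x 0).im = 0 ∧ (T.obs D x 1).re = 0 := by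
  rw [show DualCurrentTemplateR ↔ ∃ T : LocalParafermionicTemplate, T.IsExactCR ∧ T.Nondegenerate
    from LocalParafermionicTemplate.exists_isExactCR_and_nondegenerate_iff.symm]
  constructor
  · rintro ⟨T, hCR, hND⟩
    rcases nondegenerate_rePart_or_imPart hND with h | h
    · exact ⟨rePart T, isExactCR_rePart hCR, h, rePart_realForm T⟩
    · exact ⟨imPart T, isExactCR_imPart hCR, h, imPart_realForm T⟩
  · rintro ⟨T, hCR, hND, -⟩
    exact ⟨T, hCR, hND⟩

/-- **Exact CR of a real-form template = one real discrete Cauchy–Riemann pair.** For a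
template whose horizontal observable is real and whose vertical observable is purely imaginary
in `D`, the complex Duffin relations `G(N) - G(S) = i (G(E) - G(W))` at deep vertices and faces
are equivalent to the REAL relations `d(x) - d(x - e₁) = a(x) - a(x - e₀)` (vertices) and
`a(f + e₁) - a(f) = -(d(f + e₀) - d(f))` (faces) for the pair `a = Re G(·,0)` (horizontal edges),
`d = Im G(·,1)` (vertical edges) — a discrete harmonic-conjugate pair on the two interlaced
copies of `ℤ²` formed by the horizontal and the vertical edge midpoints. [folklore] -/
theorem isExactCRIn_iff_realPair (T : LocalParafermionicTemplate) {D : DiscreteDobrushin}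
    (hreal : ∀ x : Site 2, (T.obs D x 0).im = 0 ∧ (T.obs D x 1).re = 0) :
    T.IsExactCRIn D ↔
      (∀ x, T.IsDeep D x 0 → T.IsDeep D x 1 → T.IsDeep D (x - Pi.single 0 1) 0 →
          T.IsDeep D (x - Pi.single 1 1) 1 →
        (T.obs D x 1).im - (T.obs D (x - Pi.single 1 1) 1).im =
          (T.obs D x 0).re - (T.obs D (x - Pi.single 0 1) 0).re) ∧
      (∀ f, T.IsDeep D f 0 → T.IsDeep D (f + Pi.single 1 1) 0 → T.IsDeep D f 1 →
          T.IsDeep D (f + Pi.single 0 1) 1 →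
        (T.obs D (f + Pi.single 1 1) 0).re - (T.obs D f 0).re =
          -((T.obs D (f + Pi.single 0 1) 1).im - (T.obs D f 1).im)) := by
  unfold LocalParafermionicTemplate.IsExactCRIn
  refine and_congr (forall_congr' fun x => ?_) (forall_congr' fun f => ?_)
  · refine imp_congr_right fun _ => imp_congr_right fun _ => imp_congr_right fun _ =>
      imp_congr_right fun _ => ?_
    rw [Complex.ext_iff]
    simp only [sub_re, sub_im, mul_re, mul_im, I_re, I_im, zero_mul, one_mul, zero_add,
      (hreal x).1, (hreal x).2, (hreal (x - Pi.single 1 1)).2, (hreal (x - Pi.single 0 1)).1,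
      sub_zero, true_and]
  · refine imp_congr_right fun _ => imp_congr_right fun _ => imp_congr_right fun _ =>
      imp_congr_right fun _ => ?_
    rw [Complex.ext_iff]
    simp only [sub_re, sub_im, mul_re, mul_im, I_re, I_im, zero_mul, one_mul, zero_sub, zero_add,
      (hreal f).1, (hreal f).2, (hreal (f + Pi.single 1 1)).1, (hreal (f + Pi.single 0 1)).2,
      sub_zero, neg_sub, and_true]

/-! ### Consequence for the SHAPE stub: real-form templates have no projective limit -/

/-- Locally uniform convergence on a set is insensitive to an eventual modification of the
approximants on the set. [folklore] -/
theorem tendstoLocallyUniformlyOn_of_eventually_eqOn {ι α β : Type*} [TopologicalSpace α]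
    [UniformSpace β] {F F' : ι → α → β} {f : α → β} {p : Filter ι} {s : Set α}
    (h : TendstoLocallyUniformlyOn F f p s) (h' : ∀ᶠ n in p, ∀ y ∈ s, F n y = F' n y) :
    TendstoLocallyUniformlyOn F' f p s := by
  intro u hu x hx
  obtain ⟨t, ht, hev⟩ := h u hu x hx
  refine ⟨t ∩ s, inter_mem ht self_mem_nhdsWithin, ?_⟩
  filter_upwards [hev, h'] with n hn hn' y hy
  rw [← hn' y hy.2]
  exact hn y hy.1

/-- **A real-form template has no projective limit (horizontal type).** If the horizontal
observable of `T` is real in every admissible domain then, for every Dobrushin domain `D`, every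
`ZdDiscretisationFamily E`, every conformal `φ : ℍ → D`, every holomorphic cube root `q` of
`ψ'/ψ` (`ψ = φ⁻¹`) and every complex renormalisation `c_δ`, the convergence
`c_δ · T.obs (E δ) ⌊w/δ⌋ 0 → q` locally uniformly on `D` is impossible: the conjugate-staggering
`T†` has the same horizontal observable on the (eventually admissible) data `E δ`, and `T`, `T†`
cannot both converge projectively (`conjStagger_projective_false`).  Hence the exactly-CR template
that the SHAPE stub re-chooses under r2 cannot be a single real-form current. [folklore] -/
theorem realForm_projective_false (T : LocalParafermionicTemplate)
    (hreal : ∀ D : DiscreteDobrushin, D.IsZdAdmissible → ∀ x : Site 2, (T.obs D x 0).im = 0)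
    {D : DobrushinDomain} {E : ℝ → DiscreteDobrushin} (hE : ZdDiscretisationFamily D E)
    (φ : ConformalEquiv UpperHalfPlane.upperHalfPlaneSet D.carrier) {q : ℂ → ℂ}
    (hq : DifferentiableOn ℂ q D.carrier)
    (hq3 : ∀ w ∈ D.carrier, q w ^ 3 = deriv φ.symm w / φ.symm w) {c : ℝ → ℂ}
    (h : TendstoLocallyUniformlyOn
      (fun (δ : ℝ) (w : ℂ) => c δ * T.obs (E δ) (fun j => ⌊(if j = 0 then w.re else w.im) / δ⌋) 0)
      q (𝓝[>] (0 : ℝ)) D.carrier) : False := by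
  have hq0 : ∀ w ∈ D.carrier, q w ≠ 0 := by
    intro w hw h0
    have h1 := hq3 w hw
    rw [h0, zero_pow three_ne_zero] at h1
    exact deriv_symm_div_symm_ne_zero φ hw h1.symm
  refine conjStagger_projective_false T φ hq hq3 hq0 h (c' := c)
    (tendstoLocallyUniformlyOn_of_eventually_eqOn h ?_)
  filter_upwards [hE.eventually_isZdAdmissible] with δ hδ w _
  rw [obs_conjStagger_zero, (Complex.conj_eq_iff_im).2 (hreal _ hδ _)]

/-- **Real-form templates have no projective limit** (closed form of `realForm_projective_false`,
registered sub-goal `realForm_not_projective` of line `registered`): for a template whose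
horizontal observable is real in every admissible domain, NO complex renormalisation
`c_δ · T.obs (E δ) ⌊w/δ⌋ 0` converges locally uniformly to a holomorphic cube root `q` of `ψ'/ψ`,
in any Dobrushin domain, along any discretisation family, for any conformal `φ : ℍ → D`.
[folklore] -/
theorem realForm_not_projective : ∀ T : Literature.Probability.LatticeModels.LocalParafermionicTemplate, (∀ D : Literature.Probability.LatticeModels.DiscreteDobrushin, D.IsZdAdmissible → ∀ x : Literature.Probability.LatticeModels.Site 2, (T.obs D x 0).im = 0) → ∀ (D : Literature.Probability.RandomPlanarGeometry.DobrushinDomain) (E : ℝ → Literature.Probability.LatticeModels.DiscreteDobrushin), Literature.Probability.LatticeModels.ZdDiscretisationFamily D E → ∀ (φ : Literature.Probability.RandomPlanarGeometry.ConformalEquiv UpperHalfPlane.upperHalfPlaneSet D.carrier) (q : ℂ → ℂ), DifferentiableOn ℂ q D.carrier → (∀ w ∈ D.carrier, q w ^ 3 = deriv φ.symm w / φ.symm w) → ∀ c : ℝ → ℂ, ¬ TendstoLocallyUniformlyOn (fun (δ : ℝ) (w : ℂ) => c δ * T.obs (E δ) (fun j => ⌊(if j = 0 then w.re else w.im) /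 δ⌋) 0) q (𝓝[>] (0 : ℝ)) D.carrier :=
  fun T hreal _ _ hE φ _ hq hq3 _ h => realForm_projective_false T hreal hE φ hq hq3 h

end RealForm

end Summit.CriticalPhenomena.CardyFormulaZ2.Cruxes.CanonicalLimitFromExactCR.Birth

end
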